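import Summits.CriticalPhenomena.PercolationContinuityZ3.Theorems.PercNearOneGluingNoHeavyLowerTailSahiCTCLadderThreeRowTwoDensePrep
import HarnessLib

/-!
# `NoHeavyLowerTail` (crux stmt-CriticalPhenomena-4575), P3 lane: the row `#dbl = 2` of `(L_3)` in the dense-triple regime — PART 2/3: the two density-facts lemmas (`rowTwo_density_facts_R`, `rowTwo_density_facts_ML`)

Support file (seat `prim-l12-p3`, gen 26, split into three files ≤ 400 lines and landed gen 42; `--supports stmt-CriticalPhenomena-4575`).  Memo g26 §4.12.  For a profile `m = 2·1_D + 1_T`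
with `#D = 2` the cubes of `[m](e_3·H)` are the 3-live RESTRICTIONS `κ(∅, D ∪ T∖y)` (`y ∈ T`), the 2-live LINKS `κ({d_i}, d_j ∪ T∖Q)`
(`Q ⊆ T` a pair) and the 1-live double links `κ(D, T∖E)` (`E ⊆ T` a triple); the charge is `cH(3,τ+1)·a + cH(2,τ−1)·(q₁+q₂) +
cH(1,τ−3)·ε` with `a = #{y : D + y ∈ 𝒳∩𝒵}`, `q_j = #{Q : d_j + Q ∈ 𝒳∩𝒵}`, `ε = #{E ⊆ T : E ∈ 𝒳∩𝒵}`.  Peeling the restriction cubes at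
`d₁` and `d₂` (`kap_rec`) and bounding every resulting cube by t-DENSITY proves the row whenever `6ε ≥ a(τ−1)(τ−2)` (triples at least as
dense as the set `𝒜`): **`coeff_ladder_three_rowTwo_nonneg_of_dense`** (`τ ≥ 7`; exact at `H_3`).  Nothing is asserted about the crux.
-/

namespace Summit.CriticalPhenomena.PercolationContinuityZ3.Theorems.SahiCTCForms

open Finset MvPolynomial SahiCTCGenFun SahiCTCWeightedLYM

variable {α : Type*} [DecidableEq α] [Fintype α]

section RowTwo
variable {𝒳 𝒵 : Finset (Finset α)}

omit [Fintype α] in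
/-- The summed t-DENSITY facts of the RESTRICTION pieces of the row `#dbl = 2` (`n = τ − 1 ≥ 6`). [this work] -/
theorem rowTwo_density_facts_R (h𝒳 : IsUpperSet (𝒳 : Set (Finset α))) (h𝒵 : IsUpperSet (𝒵 : Set (Finset α)))
    (hX3 : ∀ S ∈ 𝒳, 3 ≤ #S) (hZ3 : ∀ S ∈ 𝒵, 3 ≤ #S) {m : α →₀ ℕ} (hD : #(dbl m) = 2) {d₁ d₂ : α} (hDeq : dbl m = {d₁, d₂})
    {n : ℕ} (hn : #(lev m 1) = n + 1) (hn6 : 6 ≤ n) :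
    ((#(((lev m 1).powersetCard 1).filter fun Y => dbl m ∪ Y ∈ 𝒳 ∧ dbl m ∪ Y ∈ 𝒵) : ℤ) ≤
        ∑ Y ∈ (lev m 1).powersetCard 1, kap 𝒳 𝒵 (dbl m) (lev m 1 \ Y)) ∧
    (2 * ((n : ℤ) + 1) * ((#(((lev m 1).powersetCard 2).filter fun Q => insert d₁ Q ∈ 𝒳 ∧ insert d₁ Q ∈ 𝒵) : ℤ) +
        #(((lev m 1).powersetCard 2).filter fun Q => insert d₂ Q ∈ 𝒳 ∧ insert d₂ Q ∈ 𝒵)) ≤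
      (n : ℤ) * (∑ Y ∈ (lev m 1).powersetCard 1, kap 𝒳 𝒵 {d₁} (lev m 1 \ Y) + ∑ Y ∈ (lev m 1).powersetCard 1, kap 𝒳 𝒵 {d₂} (lev m 1 \ Y))) ∧
    (6 * (cH 3 n : ℤ) * #(((lev m 1).powersetCard 3).filter fun E => E ∈ 𝒳 ∧ E ∈ 𝒵) ≤
      (n : ℤ) * (n - 1) * ∑ Y ∈ (lev m 1).powersetCard 1, kap 𝒳 𝒵 ∅ (lev m 1 \ Y)) := by
  have hDT : Disjoint (dbl m) (lev m 1) := disjoint_dbl_lev_one m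
  have hd₁ : d₁ ∈ dbl m := by rw [hDeq]; simp
  have hd₂ : d₂ ∈ dbl m := by rw [hDeq]; simp
  have hd₁T : d₁ ∉ lev m 1 := fun h => disjoint_left.1 hDT hd₁ h
  have hd₂T : d₂ ∉ lev m 1 := fun h => disjoint_left.1 hDT hd₂ h
  set A1 := ((lev m 1).powersetCard 1).filter fun Y => dbl m ∪ Y ∈ 𝒳 ∧ dbl m ∪ Y ∈ 𝒵 with hA1
  set Q1 := ((lev m 1).powersetCard 2).filter fun Q => insert d₁ Q ∈ 𝒳 ∧ insert d₁ Q ∈ 𝒵 with hQ1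
  set Q2 := ((lev m 1).powersetCard 2).filter fun Q => insert d₂ Q ∈ 𝒳 ∧ insert d₂ Q ∈ 𝒵 with hQ2
  set ET := ((lev m 1).powersetCard 3).filter fun E => E ∈ 𝒳 ∧ E ∈ 𝒵 with hET
  have h1n : 1 ≤ n := by omega
  have h2n : 2 ≤ n := by omega
  -- liveness of traces
  have hl3X : ∀ s, ∀ U ∈ tr 𝒳 ∅ s, 3 ≤ #U := fun s U hU => hX3 U (by simpa using (mem_tr.1 hU).2)
  have hl3Z : ∀ s, ∀ U ∈ tr 𝒵 ∅ s, 3 ≤ #U := fun s U hU => hZ3 U (by simpa using (mem_tr.1 hU).2)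
  have hl2X : ∀ d s, ∀ U ∈ tr 𝒳 {d} s, 2 ≤ #U := fun d s U hU => by
    have := hX3 _ (mem_tr.1 hU).2; have := card_union_le ({d} : Finset α) U; rw [card_singleton] at this; omega
  have hl2Z : ∀ d s, ∀ U ∈ tr 𝒵 {d} s, 2 ≤ #U := fun d s U hU => by
    have := hZ3 _ (mem_tr.1 hU).2; have := card_union_le ({d} : Finset α) U; rw [card_singleton] at this; omega
  have hl1X : ∀ s, ∀ U ∈ tr 𝒳 (dbl m) s, 1 ≤ #U := fun s U hU => by
    have := hX3 _ (mem_tr.1 hU).2; have := card_union_le (dbl m) U; omega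
  have hl1Z : ∀ s, ∀ U ∈ tr 𝒵 (dbl m) s, 1 ≤ #U := fun s U hU => by
    have := hZ3 _ (mem_tr.1 hU).2; have := card_union_le (dbl m) U; omega
  -- common sets of the traces
  have hcs3 : ∀ s, s ⊆ lev m 1 → csetsT 𝒳 𝒵 ∅ s 3 = ET.filter fun w => w ⊆ s := fun s hs => by
    ext w; simp only [csetsT, ET, mem_filter, mem_powersetCard, empty_union]
    constructor
    · rintro ⟨⟨hws, hw3⟩, hX, hZ⟩; exact ⟨⟨⟨hws.trans hs, hw3⟩, hX, hZ⟩, hws⟩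
    · rintro ⟨⟨⟨_, hw3⟩, hX, hZ⟩, hws⟩; exact ⟨⟨hws, hw3⟩, hX, hZ⟩
  have hcs2 : ∀ (d : α) (Qd : Finset (Finset α)), Qd = ((lev m 1).powersetCard 2).filter (fun Q => insert d Q ∈ 𝒳 ∧ insert d Q ∈ 𝒵) →
      ∀ s, s ⊆ lev m 1 → csetsT 𝒳 𝒵 {d} s 2 = Qd.filter fun w => w ⊆ s := fun d Qd hQd s hs => by
    ext w; simp only [csetsT, hQd, mem_filter, mem_powersetCard, insert_eq]
    constructor
    · rintro ⟨⟨hws, hw2⟩, hX, hZ⟩; exact ⟨⟨⟨hws.trans hs, hw2⟩, hX, hZ⟩, hws⟩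
    · rintro ⟨⟨⟨_, hw2⟩, hX, hZ⟩, hws⟩; exact ⟨⟨hws, hw2⟩, hX, hZ⟩
  have hcs1 : ∀ s, s ⊆ lev m 1 → csetsT 𝒳 𝒵 (dbl m) s 1 = A1.filter fun w => w ⊆ s := fun s hs => by
    ext w; simp only [csetsT, A1, mem_filter, mem_powersetCard]
    constructor
    · rintro ⟨⟨hws, hw1⟩, hX, hZ⟩; exact ⟨⟨⟨hws.trans hs, hw1⟩, hX, hZ⟩, hws⟩
    · rintro ⟨⟨⟨_, hw1⟩, hX, hZ⟩, hws⟩; exact ⟨⟨hws, hw1⟩, hX, hZ⟩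
  have hnY : ∀ Y ∈ (lev m 1).powersetCard 1, #(lev m 1 \ Y) = n := fun Y hY => by
    rw [card_sdiff_of_subset (mem_powersetCard.1 hY).1, (mem_powersetCard.1 hY).2]; omega
  have hnQ : ∀ Q ∈ (lev m 1).powersetCard 2, #(lev m 1 \ Q) = n - 1 := fun Q hQ => by
    rw [card_sdiff_of_subset (mem_powersetCard.1 hQ).1, (mem_powersetCard.1 hQ).2]; omega
  have hnE : ∀ E ∈ (lev m 1).powersetCard 3, #(lev m 1 \ E) = n - 2 := fun E hE => by
    rw [card_sdiff_of_subset (mem_powersetCard.1 hE).1, (mem_powersetCard.1 hE).2]; omega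
  have hcH2 : ∀ k, 3 ≤ k → cH 2 k = k + 1 := fun k hk => by
    unfold cH; rw [show min 2 (k + 1 - 2) = 2 from by omega]; simp [sum_range_succ]; omega
  have hcH1 : ∀ k, 1 ≤ k → cH 1 k = 1 := fun k hk => by
    unfold cH; rw [show min 1 (k + 1 - 1) = 1 from by omega]; simp
  -- numeric constants
  have e2 : ((n.choose 2 : ℕ) : ℤ) * 2 = (n : ℤ) * (n - 1) := by
    have h2 : n.choose 2 * 2 = n * (n - 1) := by rw [Nat.choose_two_right]; exact Nat.div_mul_cancel (Nat.even_mul_pred_self n).two_dvd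
    have := congrArg (fun k : ℕ => (k : ℤ)) h2; push_cast [Nat.cast_sub h1n] at this; linarith
  have e2' : (((n - 1).choose 2 : ℕ) : ℤ) * 2 = ((n : ℤ) - 1) * (n - 2) := by
    have h2 : (n - 1).choose 2 * 2 = (n - 1) * (n - 1 - 1) := by
      rw [Nat.choose_two_right]; exact Nat.div_mul_cancel (Nat.even_mul_pred_self _).two_dvd
    have := congrArg (fun k : ℕ => (k : ℤ)) h2
    push_cast [Nat.cast_sub h1n, Nat.cast_sub (by omega : 1 ≤ n - 1)] at this
    linarith [this]
  have e3 : ((n.choose 3 : ℕ) : ℤ) * 3 = (((n - 1).choose 2 : ℕ) : ℤ) * n := by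
    have h3 : n.choose 3 * 3 = (n - 1).choose 2 * n := by
      have := Nat.add_one_mul_choose_eq (n - 1) 2; rw [show n - 1 + 1 = n from by omega] at this; linarith
    exact_mod_cast h3
  -- per-cube density facts
  have hR3 : ∀ Y ∈ (lev m 1).powersetCard 1, (cH 3 n : ℤ) * #(ET.filter fun w => w ⊆ lev m 1 \ Y) ≤ (n.choose 3 : ℤ) * kap 𝒳 𝒵 ∅ (lev m 1 \ Y) :=
    fun Y hY => by
    have h := densityT_le_kap h𝒳 h𝒵 3 n ∅ (lev m 1 \ Y) (disjoint_empty_left _) (hnY Y hY) (hl3X _) (hl3Z _)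
    rw [hcs3 _ sdiff_subset] at h; exact h
  have hR2 : ∀ (d : α) (Qd : Finset (Finset α)), d ∉ lev m 1 →
      Qd = ((lev m 1).powersetCard 2).filter (fun Q => insert d Q ∈ 𝒳 ∧ insert d Q ∈ 𝒵) →
      ∀ Y ∈ (lev m 1).powersetCard 1, (((n + 1 : ℕ)) : ℤ) * #(Qd.filter fun w => w ⊆ lev m 1 \ Y) ≤ (n.choose 2 : ℤ) * kap 𝒳 𝒵 {d} (lev m 1 \ Y) :=
    fun d Qd hdT hQd Y hY => by
    have h := densityT_le_kap h𝒳 h𝒵 2 n {d} (lev m 1 \ Y) (disjoint_singleton_left.2 fun h => hdT (mem_sdiff.1 h).1) (hnY Y hY)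
      (hl2X d _) (hl2Z d _)
    rw [hcs2 d Qd hQd _ sdiff_subset, hcH2 n (by omega)] at h; exact h
  have hR1 : ∀ Y ∈ (lev m 1).powersetCard 1, (1 : ℤ) * #(A1.filter fun w => w ⊆ lev m 1 \ Y) ≤ (n.choose 1 : ℤ) * kap 𝒳 𝒵 (dbl m) (lev m 1 \ Y) :=
    fun Y hY => by
    have h := densityT_le_kap h𝒳 h𝒵 1 n (dbl m) (lev m 1 \ Y) (hDT.mono_right sdiff_subset) (hnY Y hY) (hl1X _) (hl1Z _)
    rw [hcs1 _ sdiff_subset, hcH1 n (by omega)] at h; exact_mod_cast h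
  have hA1' : ∀ w ∈ A1, w ⊆ lev m 1 ∧ #w = 1 := fun w hw => mem_powersetCard.1 (mem_filter.1 hw).1
  have hQ1' : ∀ w ∈ Q1, w ⊆ lev m 1 ∧ #w = 2 := fun w hw => mem_powersetCard.1 (mem_filter.1 hw).1
  have hQ2' : ∀ w ∈ Q2, w ⊆ lev m 1 ∧ #w = 2 := fun w hw => mem_powersetCard.1 (mem_filter.1 hw).1
  have hET' : ∀ w ∈ ET, w ⊆ lev m 1 ∧ #w = 3 := fun w hw => mem_powersetCard.1 (mem_filter.1 hw).1
  have sR3 := sum_le_sum hR3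
  have sR2a := sum_le_sum (hR2 d₁ Q1 hd₁T hQ1)
  have sR2b := sum_le_sum (hR2 d₂ Q2 hd₂T hQ2)
  have sR1 := sum_le_sum hR1
  rw [← mul_sum, ← mul_sum] at sR3 sR2a sR2b sR1
  rw [show ∑ x ∈ (lev m 1).powersetCard 1, (#(ET.filter fun w => w ⊆ lev m 1 \ x) : ℤ) = (#ET * (#(lev m 1) - 3).choose 1 : ℕ) from by
    exact_mod_cast sum_card_filter_subset_sdiff hET' 1] at sR3
  rw [show ∑ x ∈ (lev m 1).powersetCard 1, (#(Q1.filter fun w => w ⊆ lev m 1 \ x) : ℤ) = (#Q1 * (#(lev m 1) - 2).choose 1 : ℕ) from by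
    exact_mod_cast sum_card_filter_subset_sdiff hQ1' 1] at sR2a
  rw [show ∑ x ∈ (lev m 1).powersetCard 1, (#(Q2.filter fun w => w ⊆ lev m 1 \ x) : ℤ) = (#Q2 * (#(lev m 1) - 2).choose 1 : ℕ) from by
    exact_mod_cast sum_card_filter_subset_sdiff hQ2' 1] at sR2b
  rw [show ∑ x ∈ (lev m 1).powersetCard 1, (#(A1.filter fun w => w ⊆ lev m 1 \ x) : ℤ) = (#A1 * (#(lev m 1) - 1).choose 1 : ℕ) from by
    exact_mod_cast sum_card_filter_subset_sdiff hA1' 1] at sR1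
  rw [hn] at sR3 sR2a sR2b sR1
  simp only [Nat.add_sub_cancel, Nat.choose_one_right, show n + 1 - 3 = n - 2 from by omega,
    show n + 1 - 2 = n - 1 from by omega] at sR3 sR2a sR2b sR1
  push_cast [Nat.cast_sub h1n, Nat.cast_sub h2n] at sR3 sR2a sR2b sR1
  generalize hB3 : ∑ Y ∈ (lev m 1).powersetCard 1, kap 𝒳 𝒵 ∅ (lev m 1 \ Y) = B3 at sR3 ⊢
  generalize hB2a : ∑ Y ∈ (lev m 1).powersetCard 1, kap 𝒳 𝒵 {d₁} (lev m 1 \ Y) = B2a at sR2a ⊢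
  generalize hB2b : ∑ Y ∈ (lev m 1).powersetCard 1, kap 𝒳 𝒵 {d₂} (lev m 1 \ Y) = B2b at sR2b ⊢
  generalize hB1 : ∑ Y ∈ (lev m 1).powersetCard 1, kap 𝒳 𝒵 (dbl m) (lev m 1 \ Y) = B1 at sR1 ⊢
  generalize ha : (#A1 : ℤ) = a at sR1 ⊢
  generalize hq1 : (#Q1 : ℤ) = q1 at sR2a ⊢
  generalize hq2 : (#Q2 : ℤ) = q2 at sR2b ⊢
  generalize hε : (#ET : ℤ) = ε at sR3 ⊢
  generalize hc3 : (cH 3 n : ℤ) = cH3 at sR3 ⊢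
  generalize hC2 : ((n.choose 2 : ℕ) : ℤ) = C2 at sR2a sR2b e2
  generalize hC3 : ((n.choose 3 : ℕ) : ℤ) = C3 at sR3 e3
  generalize hC2' : (((n - 1).choose 2 : ℕ) : ℤ) = C2' at e2' e3
  generalize hnz : (n : ℤ) = nz at *
  have hnz6 : (6 : ℤ) ≤ nz := by rw [← hnz]; exact_mod_cast hn6
  have hnzpos : (0 : ℤ) < nz := by linarith
  refine ⟨le_of_mul_le_mul_left (by linarith [sR1]) hnzpos, ?_, ?_⟩
  · have hpos : (0 : ℤ) < nz - 1 := by linarith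
    refine le_of_mul_le_mul_left ?_ hpos
    have h1 : 2 * ((nz + 1) * (q1 * (nz - 1))) + 2 * ((nz + 1) * (q2 * (nz - 1))) ≤ 2 * (C2 * B2a) + 2 * (C2 * B2b) := by
      linarith [sR2a, sR2b]
    have h2 : 2 * (C2 * B2a) + 2 * (C2 * B2b) = nz * (nz - 1) * (B2a + B2b) := by rw [← e2]; ring
    have h3 : (nz - 1) * (2 * (nz + 1) * (q1 + q2)) = 2 * ((nz + 1) * (q1 * (nz - 1))) + 2 * ((nz + 1) * (q2 * (nz - 1))) := by ring
    have h4 : (nz - 1) * (nz * (B2a + B2b)) = nz * (nz - 1) * (B2a + B2b) := by ring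
    rw [h3, h4, ← h2]; exact h1
  · have hpos : (0 : ℤ) < nz - 2 := by linarith
    have e6 : C3 * 6 = nz * (nz - 1) * (nz - 2) := by
      have : C3 * 6 = (C3 * 3) * 2 := by ring
      rw [this, e3, mul_assoc, mul_comm nz 2, ← mul_assoc, e2']; ring
    refine le_of_mul_le_mul_left ?_ hpos
    have h2 : (nz - 2) * (nz * (nz - 1) * B3) = 6 * (C3 * B3) := by
      have : 6 * (C3 * B3) = (C3 * 6) * B3 := by ring
      rw [this, e6]; ring
    have h3 : (nz - 2) * (6 * cH3 * ε) = 6 * (cH3 * (ε * (nz - 2))) := by ring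
    rw [h2, h3]; linarith [sR3]

omit [Fintype α] in
/-- The summed t-DENSITY facts of the LINK and DOUBLE-LINK pieces of the row `#dbl = 2` (`n = τ − 1 ≥ 6`). [this work] -/
theorem rowTwo_density_facts_ML (h𝒳 : IsUpperSet (𝒳 : Set (Finset α))) (h𝒵 : IsUpperSet (𝒵 : Set (Finset α)))
    (hX3 : ∀ S ∈ 𝒳, 3 ≤ #S) (hZ3 : ∀ S ∈ 𝒵, 3 ≤ #S) {m : α →₀ ℕ} (hD : #(dbl m) = 2) {d₁ d₂ : α} (hDeq : dbl m = {d₁, d₂})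
    {n : ℕ} (hn : #(lev m 1) = n + 1) (hn6 : 6 ≤ n) :
    ((n : ℤ) * ((#(((lev m 1).powersetCard 2).filter fun Q => insert d₁ Q ∈ 𝒳 ∧ insert d₁ Q ∈ 𝒵) : ℤ) +
        #(((lev m 1).powersetCard 2).filter fun Q => insert d₂ Q ∈ 𝒳 ∧ insert d₂ Q ∈ 𝒵)) ≤
      ∑ Q ∈ (lev m 1).powersetCard 2, kap 𝒳 𝒵 {d₂} (lev m 1 \ Q) + ∑ Q ∈ (lev m 1).powersetCard 2, kap 𝒳 𝒵 {d₁} (lev m 1 \ Q)) ∧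
    ((#(((lev m 1).powersetCard 1).filter fun Y => dbl m ∪ Y ∈ 𝒳 ∧ dbl m ∪ Y ∈ 𝒵) : ℤ) * n ≤
      2 * ∑ Q ∈ (lev m 1).powersetCard 2, kap 𝒳 𝒵 (dbl m) (lev m 1 \ Q)) ∧
    ((#(((lev m 1).powersetCard 1).filter fun Y => dbl m ∪ Y ∈ 𝒳 ∧ dbl m ∪ Y ∈ 𝒵) : ℤ) * n * (n - 1) ≤
      6 * ∑ E ∈ (lev m 1).powersetCard 3, kap 𝒳 𝒵 (dbl m) (lev m 1 \ E)) := by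
  have hDT : Disjoint (dbl m) (lev m 1) := disjoint_dbl_lev_one m
  have hd₁ : d₁ ∈ dbl m := by rw [hDeq]; simp
  have hd₂ : d₂ ∈ dbl m := by rw [hDeq]; simp
  have hd₁T : d₁ ∉ lev m 1 := fun h => disjoint_left.1 hDT hd₁ h
  have hd₂T : d₂ ∉ lev m 1 := fun h => disjoint_left.1 hDT hd₂ h
  set A1 := ((lev m 1).powersetCard 1).filter fun Y => dbl m ∪ Y ∈ 𝒳 ∧ dbl m ∪ Y ∈ 𝒵 with hA1
  set Q1 := ((lev m 1).powersetCard 2).filter fun Q => insert d₁ Q ∈ 𝒳 ∧ insert d₁ Q ∈ 𝒵 with hQ1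
  set Q2 := ((lev m 1).powersetCard 2).filter fun Q => insert d₂ Q ∈ 𝒳 ∧ insert d₂ Q ∈ 𝒵 with hQ2
  set ET := ((lev m 1).powersetCard 3).filter fun E => E ∈ 𝒳 ∧ E ∈ 𝒵 with hET
  have h1n : 1 ≤ n := by omega
  have h2n : 2 ≤ n := by omega
  -- liveness of traces
  have hl3X : ∀ s, ∀ U ∈ tr 𝒳 ∅ s, 3 ≤ #U := fun s U hU => hX3 U (by simpa using (mem_tr.1 hU).2)
  have hl3Z : ∀ s, ∀ U ∈ tr 𝒵 ∅ s, 3 ≤ #U := fun s U hU => hZ3 U (by simpa using (mem_tr.1 hU).2)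
  have hl2X : ∀ d s, ∀ U ∈ tr 𝒳 {d} s, 2 ≤ #U := fun d s U hU => by
    have := hX3 _ (mem_tr.1 hU).2; have := card_union_le ({d} : Finset α) U; rw [card_singleton] at this; omega
  have hl2Z : ∀ d s, ∀ U ∈ tr 𝒵 {d} s, 2 ≤ #U := fun d s U hU => by
    have := hZ3 _ (mem_tr.1 hU).2; have := card_union_le ({d} : Finset α) U; rw [card_singleton] at this; omega
  have hl1X : ∀ s, ∀ U ∈ tr 𝒳 (dbl m) s, 1 ≤ #U := fun s U hU => by
    have := hX3 _ (mem_tr.1 hU).2; have := card_union_le (dbl m) U; omega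
  have hl1Z : ∀ s, ∀ U ∈ tr 𝒵 (dbl m) s, 1 ≤ #U := fun s U hU => by
    have := hZ3 _ (mem_tr.1 hU).2; have := card_union_le (dbl m) U; omega
  -- common sets of the traces
  have hcs3 : ∀ s, s ⊆ lev m 1 → csetsT 𝒳 𝒵 ∅ s 3 = ET.filter fun w => w ⊆ s := fun s hs => by
    ext w; simp only [csetsT, ET, mem_filter, mem_powersetCard, empty_union]
    constructor
    · rintro ⟨⟨hws, hw3⟩, hX, hZ⟩; exact ⟨⟨⟨hws.trans hs, hw3⟩, hX, hZ⟩, hws⟩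
    · rintro ⟨⟨⟨_, hw3⟩, hX, hZ⟩, hws⟩; exact ⟨⟨hws, hw3⟩, hX, hZ⟩
  have hcs2 : ∀ (d : α) (Qd : Finset (Finset α)), Qd = ((lev m 1).powersetCard 2).filter (fun Q => insert d Q ∈ 𝒳 ∧ insert d Q ∈ 𝒵) →
      ∀ s, s ⊆ lev m 1 → csetsT 𝒳 𝒵 {d} s 2 = Qd.filter fun w => w ⊆ s := fun d Qd hQd s hs => by
    ext w; simp only [csetsT, hQd, mem_filter, mem_powersetCard, insert_eq]
    constructor
    · rintro ⟨⟨hws, hw2⟩, hX, hZ⟩; exact ⟨⟨⟨hws.trans hs, hw2⟩, hX, hZ⟩, hws⟩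
    · rintro ⟨⟨⟨_, hw2⟩, hX, hZ⟩, hws⟩; exact ⟨⟨hws, hw2⟩, hX, hZ⟩
  have hcs1 : ∀ s, s ⊆ lev m 1 → csetsT 𝒳 𝒵 (dbl m) s 1 = A1.filter fun w => w ⊆ s := fun s hs => by
    ext w; simp only [csetsT, A1, mem_filter, mem_powersetCard]
    constructor
    · rintro ⟨⟨hws, hw1⟩, hX, hZ⟩; exact ⟨⟨⟨hws.trans hs, hw1⟩, hX, hZ⟩, hws⟩
    · rintro ⟨⟨⟨_, hw1⟩, hX, hZ⟩, hws⟩; exact ⟨⟨hws, hw1⟩, hX, hZ⟩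
  have hnY : ∀ Y ∈ (lev m 1).powersetCard 1, #(lev m 1 \ Y) = n := fun Y hY => by
    rw [card_sdiff_of_subset (mem_powersetCard.1 hY).1, (mem_powersetCard.1 hY).2]; omega
  have hnQ : ∀ Q ∈ (lev m 1).powersetCard 2, #(lev m 1 \ Q) = n - 1 := fun Q hQ => by
    rw [card_sdiff_of_subset (mem_powersetCard.1 hQ).1, (mem_powersetCard.1 hQ).2]; omega
  have hnE : ∀ E ∈ (lev m 1).powersetCard 3, #(lev m 1 \ E) = n - 2 := fun E hE => by
    rw [card_sdiff_of_subset (mem_powersetCard.1 hE).1, (mem_powersetCard.1 hE).2]; omega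
  have hcH2 : ∀ k, 3 ≤ k → cH 2 k = k + 1 := fun k hk => by
    unfold cH; rw [show min 2 (k + 1 - 2) = 2 from by omega]; simp [sum_range_succ]; omega
  have hcH1 : ∀ k, 1 ≤ k → cH 1 k = 1 := fun k hk => by
    unfold cH; rw [show min 1 (k + 1 - 1) = 1 from by omega]; simp
  -- numeric constants
  have e2 : ((n.choose 2 : ℕ) : ℤ) * 2 = (n : ℤ) * (n - 1) := by
    have h2 : n.choose 2 * 2 = n * (n - 1) := by rw [Nat.choose_two_right]; exact Nat.div_mul_cancel (Nat.even_mul_pred_self n).two_dvd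
    have := congrArg (fun k : ℕ => (k : ℤ)) h2; push_cast [Nat.cast_sub h1n] at this; linarith
  have e2' : (((n - 1).choose 2 : ℕ) : ℤ) * 2 = ((n : ℤ) - 1) * (n - 2) := by
    have h2 : (n - 1).choose 2 * 2 = (n - 1) * (n - 1 - 1) := by
      rw [Nat.choose_two_right]; exact Nat.div_mul_cancel (Nat.even_mul_pred_self _).two_dvd
    have := congrArg (fun k : ℕ => (k : ℤ)) h2
    push_cast [Nat.cast_sub h1n, Nat.cast_sub (by omega : 1 ≤ n - 1)] at this
    linarith [this]
  have e3 : ((n.choose 3 : ℕ) : ℤ) * 3 = (((n - 1).choose 2 : ℕ) : ℤ) * n := by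
    have h3 : n.choose 3 * 3 = (n - 1).choose 2 * n := by
      have := Nat.add_one_mul_choose_eq (n - 1) 2; rw [show n - 1 + 1 = n from by omega] at this; linarith
    exact_mod_cast h3
  -- per-cube density facts
  have hM2 : ∀ (d : α) (Qd : Finset (Finset α)), d ∉ lev m 1 →
      Qd = ((lev m 1).powersetCard 2).filter (fun Q => insert d Q ∈ 𝒳 ∧ insert d Q ∈ 𝒵) →
      ∀ Q ∈ (lev m 1).powersetCard 2, ((n : ℕ) : ℤ) * #(Qd.filter fun w => w ⊆ lev m 1 \ Q) ≤ ((n - 1).choose 2 : ℤ) * kap 𝒳 𝒵 {d} (lev m 1 \ Q) :=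
    fun d Qd hdT hQd Q hQ => by
    have h := densityT_le_kap h𝒳 h𝒵 2 (n - 1) {d} (lev m 1 \ Q) (disjoint_singleton_left.2 fun h => hdT (mem_sdiff.1 h).1) (hnQ Q hQ)
      (hl2X d _) (hl2Z d _)
    rw [hcs2 d Qd hQd _ sdiff_subset, hcH2 (n - 1) (by omega), show n - 1 + 1 = n from by omega] at h; exact h
  have hM1 : ∀ Q ∈ (lev m 1).powersetCard 2, (1 : ℤ) * #(A1.filter fun w => w ⊆ lev m 1 \ Q) ≤ ((n - 1).choose 1 : ℤ) * kap 𝒳 𝒵 (dbl m) (lev m 1 \ Q) :=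
    fun Q hQ => by
    have h := densityT_le_kap h𝒳 h𝒵 1 (n - 1) (dbl m) (lev m 1 \ Q) (hDT.mono_right sdiff_subset) (hnQ Q hQ) (hl1X _) (hl1Z _)
    rw [hcs1 _ sdiff_subset, hcH1 (n - 1) (by omega)] at h; exact_mod_cast h
  have hL1 : ∀ E ∈ (lev m 1).powersetCard 3, (1 : ℤ) * #(A1.filter fun w => w ⊆ lev m 1 \ E) ≤ ((n - 2).choose 1 : ℤ) * kap 𝒳 𝒵 (dbl m) (lev m 1 \ E) :=
    fun E hE => by
    have h := densityT_le_kap h𝒳 h𝒵 1 (n - 2) (dbl m) (lev m 1 \ E) (hDT.mono_right sdiff_subset) (hnE E hE) (hl1X _) (hl1Z _)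
    rw [hcs1 _ sdiff_subset, hcH1 (n - 2) (by omega)] at h; exact_mod_cast h
  have hA1' : ∀ w ∈ A1, w ⊆ lev m 1 ∧ #w = 1 := fun w hw => mem_powersetCard.1 (mem_filter.1 hw).1
  have hQ1' : ∀ w ∈ Q1, w ⊆ lev m 1 ∧ #w = 2 := fun w hw => mem_powersetCard.1 (mem_filter.1 hw).1
  have hQ2' : ∀ w ∈ Q2, w ⊆ lev m 1 ∧ #w = 2 := fun w hw => mem_powersetCard.1 (mem_filter.1 hw).1
  have sM2a := sum_le_sum (hM2 d₂ Q2 hd₂T hQ2)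
  have sM2b := sum_le_sum (hM2 d₁ Q1 hd₁T hQ1)
  have sM1 := sum_le_sum hM1
  have sL1 := sum_le_sum hL1
  rw [← mul_sum, ← mul_sum] at sM2a sM2b sM1 sL1
  rw [show ∑ x ∈ (lev m 1).powersetCard 2, (#(Q2.filter fun w => w ⊆ lev m 1 \ x) : ℤ) = (#Q2 * (#(lev m 1) - 2).choose 2 : ℕ) from by
    exact_mod_cast sum_card_filter_subset_sdiff hQ2' 2] at sM2a
  rw [show ∑ x ∈ (lev m 1).powersetCard 2, (#(Q1.filter fun w => w ⊆ lev m 1 \ x) : ℤ) = (#Q1 * (#(lev m 1) - 2).choose 2 : ℕ) from by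
    exact_mod_cast sum_card_filter_subset_sdiff hQ1' 2] at sM2b
  rw [show ∑ x ∈ (lev m 1).powersetCard 2, (#(A1.filter fun w => w ⊆ lev m 1 \ x) : ℤ) = (#A1 * (#(lev m 1) - 1).choose 2 : ℕ) from by
    exact_mod_cast sum_card_filter_subset_sdiff hA1' 2] at sM1
  rw [show ∑ x ∈ (lev m 1).powersetCard 3, (#(A1.filter fun w => w ⊆ lev m 1 \ x) : ℤ) = (#A1 * (#(lev m 1) - 1).choose 3 : ℕ) from by
    exact_mod_cast sum_card_filter_subset_sdiff hA1' 3] at sL1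
  rw [hn] at sM2a sM2b sM1 sL1
  simp only [Nat.add_sub_cancel, Nat.choose_one_right, show n + 1 - 2 = n - 1 from by omega] at sM2a sM2b sM1 sL1
  push_cast [Nat.cast_sub h1n, Nat.cast_sub h2n] at sM2a sM2b sM1 sL1
  generalize hN2a : ∑ Q ∈ (lev m 1).powersetCard 2, kap 𝒳 𝒵 {d₂} (lev m 1 \ Q) = N2a at sM2a ⊢
  generalize hN2b : ∑ Q ∈ (lev m 1).powersetCard 2, kap 𝒳 𝒵 {d₁} (lev m 1 \ Q) = N2b at sM2b ⊢
  generalize hN1 : ∑ Q ∈ (lev m 1).powersetCard 2, kap 𝒳 𝒵 (dbl m) (lev m 1 \ Q) = N1 at sM1 ⊢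
  generalize hLL : ∑ E ∈ (lev m 1).powersetCard 3, kap 𝒳 𝒵 (dbl m) (lev m 1 \ E) = LL at sL1 ⊢
  generalize ha : (#A1 : ℤ) = a at sM1 sL1 ⊢
  generalize hq1 : (#Q1 : ℤ) = q1 at sM2b ⊢
  generalize hq2 : (#Q2 : ℤ) = q2 at sM2a ⊢
  generalize hC2 : ((n.choose 2 : ℕ) : ℤ) = C2 at sM1 e2
  generalize hC3 : ((n.choose 3 : ℕ) : ℤ) = C3 at sL1 e3
  generalize hC2' : (((n - 1).choose 2 : ℕ) : ℤ) = C2' at sM2a sM2b e2' e3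
  generalize hnz : (n : ℤ) = nz at *
  have hnz6 : (6 : ℤ) ≤ nz := by rw [← hnz]; exact_mod_cast hn6
  have hC2'pos : 0 < C2' := by have : (0:ℤ) < (nz - 1) * (nz - 2) := mul_pos (by linarith) (by linarith); linarith [e2']
  refine ⟨?_, ?_, ?_⟩
  · refine le_of_mul_le_mul_left ?_ hC2'pos
    have h3 : C2' * (nz * (q1 + q2)) = nz * (q2 * C2') + nz * (q1 * C2') := by ring
    have h4 : C2' * (N2a + N2b) = C2' * N2a + C2' * N2b := by ring
    rw [h3, h4]; linarith [sM2a, sM2b]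
  · have hpos : (0 : ℤ) < nz - 1 := by linarith
    refine le_of_mul_le_mul_left ?_ hpos
    have h2 : (nz - 1) * (a * nz) = 2 * (a * C2) := by
      have : 2 * (a * C2) = a * (C2 * 2) := by ring
      rw [this, e2]; ring
    have h3 : (nz - 1) * (2 * N1) = 2 * ((nz - 1) * N1) := by ring
    rw [h2, h3]; linarith [sM1]
  · have hpos : (0 : ℤ) < nz - 2 := by linarith
    have e6 : C3 * 6 = nz * (nz - 1) * (nz - 2) := by
      have : C3 * 6 = (C3 * 3) * 2 := by ring
      rw [this, e3, mul_assoc, mul_comm nz 2, ← mul_assoc, e2']; ring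
    refine le_of_mul_le_mul_left ?_ hpos
    have h2 : (nz - 2) * (a * nz * (nz - 1)) = 6 * (a * C3) := by
      have : 6 * (a * C3) = a * (C3 * 6) := by ring
      rw [this, e6]; ring
    have h3 : (nz - 2) * (6 * LL) = 6 * ((nz - 2) * LL) := by ring
    rw [h2, h3]; linarith [sL1]

end RowTwo

end Summit.CriticalPhenomena.PercolationContinuityZ3.Theorems.SahiCTCForms
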